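import Summits.ValiantsHypothesis.ValiantsHypothesis.Theorems.LacunarySymmetroidMatrixDescartesDoorA26WallBubblingWeylChainSplit
import Summits.ValiantsHypothesis.ValiantsHypothesis.Theorems.LacunarySymmetroidMatrixDescartesDoorA26WallBubblingWeylTripleReduction
import Summits.ValiantsHypothesis.ValiantsHypothesis.Theorems.LacunarySymmetroidMatrixDescartesDoorA26WallBubblingWeylQuadLimit
import Summits.ValiantsHypothesis.ValiantsHypothesis.Theorems.LacunarySymmetroidMatrixDescartesDoorA26WallBubblingWeylQuintLimit
import Summits.ValiantsHypothesis.ValiantsHypothesis.Theorems.LacunarySymmetroidMatrixDescartesDoorA26WallBubblingWeyl321SingleCluster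

/-!
# Wall bubbling for `DoorA26` — `TripleStratum26` REDUCED TO FOUR SPREAD CHAINS AND THE TWO CHAINS [3,3], [4,2]

HONEST FRAMING.  Bookkeeping toward `TripleStratum26` of `Cruxes/DoorA26/Lines/wall_bubbling_ConfluentDoor.lean` (rev 13; crux `DoorA26`,
stmt-ValiantsHypothesis-19979 — OPEN, typed, never asserted).  W1 seat val-sym-door-p2 g15 (#111).  With the window/spread split #110
`twenties_window_or_spread` and the four door-free single-cluster theorems (#89 `no_twenty_window_weylTriple`, #109 `no_twenty_window_weyl321`,
#97 `no_twenty_window_weylQuadruple`, #104 `no_twenty_window_weylQuintuple`):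

* `h321_of_spread`, `h411_of_spread`, `h51_of_spread` — the chains `h321`, `h411`, `h51` of #91 follow from their SPREAD CASES (twenties with
  `z ν 0 = 0` and `z ν 19 → +∞`); `h3111_of_spread` is #110;
* **`tripleStratum26_of_spreadChains`** — `TripleStratum26` (inlined verbatim as in #91) follows from the four SPREAD CHAINS at
  [3,1,1,1], [3,2,1], [4,1,1], [5,1] and the two full chains `h33`, `h42`.

WHAT REMAINS (named): the multi-cluster statements «no twenties with z₀ = 0 and spread → ∞ converging to the stratum» at four patterns (memo §3:
chain ceiling 20 vs 19 — the sixth-, tenth- or fifteenth-slot cluster), and the patterns [3,3], [4,2] entirely (memo §4c: single cluster settled at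
generic deviation shapes on paper by the letter-Gram rank principle; degenerate shapes and multi-cluster open).  Nothing here bears on `DoorA26`,
`MatrixDescartes` (stmt-ValiantsHypothesis-18050) or `VP ≠ VNP`; `TripleStratum26`, (W), (M) OPEN.  `--supports stmt-ValiantsHypothesis-19979 --as helper`.
[this work].
-/

-- `Summit.ValiantsHypothesis.ValiantsHypothesis.…` repeats a component by the D-0017 layout
-- (single-conjunct summit), which the `dupNamespace` linter flags; the name is mandated.
set_option linter.dupNamespace false

namespace Summit.ValiantsHypothesis.ValiantsHypothesis.Theorems.LacunarySymmetroidMatrixDescartes.WallBubbling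

open Finset Filter Topology
open Bubbling (TwentyLocus SortedSimplex)
open scoped BigOperators

/-- **THE CHAIN `h321` OF #91 FOLLOWS FROM ITS SPREAD CASE** (window case: #109 `no_twenty_window_weyl321`). [this work] -/
theorem h321_of_spread
    (hspread : ∀ (δs : ℕ → Fin 6 → ℝ) (δ0 : Fin 6 → ℝ), (∀ l, Tendsto (fun ν => δs ν l) atTop (𝓝 (δ0 l))) →
      δ0 1 = δ0 0 → δ0 4 = δ0 3 → δ0 5 = δ0 3 →
      (∀ a b c d : Fin 3, δ0 ((![0, 2, 3] : Fin 3 → Fin 6) a) + δ0 ((![0, 2, 3] : Fin 3 → Fin 6) b)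
          = δ0 ((![0, 2, 3] : Fin 3 → Fin 6) c) + δ0 ((![0, 2, 3] : Fin 3 → Fin 6) d) → (a = c ∧ b = d) ∨ (a = d ∧ b = c)) →
      ∀ (U : ℕ → Fin 6 → Matrix (Fin 2) (Fin 2) ℝ), (∀ ν l, (U ν l).IsSymm) →
      (∀ ν, ∃ t, (∑ l, Real.exp (δs ν l * t) • U ν l).det ≠ 0) →
      ∀ (z : ℕ → Fin 20 → ℝ), (∀ ν, StrictMono (z ν)) → (∀ ν, z ν 0 = 0) → Tendsto (fun ν => z ν 19) atTop atTop →
      (∀ ν i, (∑ l, Real.exp (δs ν l * z ν i) • U ν l).det = 0) → False) :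
    ∀ (δs : ℕ → Fin 6 → ℝ) (δ0 : Fin 6 → ℝ), (∀ l, Tendsto (fun ν => δs ν l) atTop (𝓝 (δ0 l))) →
      δ0 1 = δ0 0 → δ0 4 = δ0 3 → δ0 5 = δ0 3 →
      (∀ a b c d : Fin 3, δ0 ((![0, 2, 3] : Fin 3 → Fin 6) a) + δ0 ((![0, 2, 3] : Fin 3 → Fin 6) b)
          = δ0 ((![0, 2, 3] : Fin 3 → Fin 6) c) + δ0 ((![0, 2, 3] : Fin 3 → Fin 6) d) → (a = c ∧ b = d) ∨ (a = d ∧ b = c)) →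
      ∀ (U : ℕ → Fin 6 → Matrix (Fin 2) (Fin 2) ℝ), (∀ ν l, (U ν l).IsSymm) →
      (∀ ν, ∃ t, (∑ l, Real.exp (δs ν l * t) • U ν l).det ≠ 0) →
      ∀ (z : ℕ → Fin 20 → ℝ), (∀ ν, StrictMono (z ν)) → (∀ ν i, (∑ l, Real.exp (δs ν l * z ν i) • U ν l).det = 0) → False := by
  intro δs δ0 hδ h10 h43 h53 hvg U hU hne z hz hroot
  refine twenties_window_or_spread δs U hU hne z hz hroot (fun φ hφ V hV hneV A B hw => ?_) (fun V hV hneV y hy hy0 ht hr => ?_)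
  · exact no_twenty_window_weyl321 (fun ν => δs (φ ν)) δ0 (fun l => (hδ l).comp hφ.tendsto_atTop) h10 h43 h53 hvg V hV hneV A B hw
  · exact hspread δs δ0 hδ h10 h43 h53 hvg V hV hneV y hy hy0 ht hr

/-- **THE CHAIN `h411` OF #91 FOLLOWS FROM ITS SPREAD CASE** (window case: #97 `no_twenty_window_weylQuadruple`). [this work] -/
theorem h411_of_spread
    (hspread : ∀ (δs : ℕ → Fin 6 → ℝ) (δ0 : Fin 6 → ℝ), (∀ l, Tendsto (fun ν => δs ν l) atTop (𝓝 (δ0 l))) →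
      δ0 3 = δ0 2 → δ0 4 = δ0 2 → δ0 5 = δ0 2 →
      (∀ a b c d : Fin 3, δ0 a.castSucc.castSucc.castSucc + δ0 b.castSucc.castSucc.castSucc
          = δ0 c.castSucc.castSucc.castSucc + δ0 d.castSucc.castSucc.castSucc → (a = c ∧ b = d) ∨ (a = d ∧ b = c)) →
      ∀ (U : ℕ → Fin 6 → Matrix (Fin 2) (Fin 2) ℝ), (∀ ν l, (U ν l).IsSymm) →
      (∀ ν, ∃ t, (∑ l, Real.exp (δs ν l * t) • U ν l).det ≠ 0) →
      ∀ (z : ℕ → Fin 20 → ℝ), (∀ ν, StrictMono (z ν)) → (∀ ν, z ν 0 = 0) → Tendsto (fun ν => z ν 19) atTop atTop →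
      (∀ ν i, (∑ l, Real.exp (δs ν l * z ν i) • U ν l).det = 0) → False) :
    ∀ (δs : ℕ → Fin 6 → ℝ) (δ0 : Fin 6 → ℝ), (∀ l, Tendsto (fun ν => δs ν l) atTop (𝓝 (δ0 l))) →
      δ0 3 = δ0 2 → δ0 4 = δ0 2 → δ0 5 = δ0 2 →
      (∀ a b c d : Fin 3, δ0 a.castSucc.castSucc.castSucc + δ0 b.castSucc.castSucc.castSucc
          = δ0 c.castSucc.castSucc.castSucc + δ0 d.castSucc.castSucc.castSucc → (a = c ∧ b = d) ∨ (a = d ∧ b = c)) →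
      ∀ (U : ℕ → Fin 6 → Matrix (Fin 2) (Fin 2) ℝ), (∀ ν l, (U ν l).IsSymm) →
      (∀ ν, ∃ t, (∑ l, Real.exp (δs ν l * t) • U ν l).det ≠ 0) →
      ∀ (z : ℕ → Fin 20 → ℝ), (∀ ν, StrictMono (z ν)) → (∀ ν i, (∑ l, Real.exp (δs ν l * z ν i) • U ν l).det = 0) → False := by
  intro δs δ0 hδ h32 h42 h52 hvg U hU hne z hz hroot
  refine twenties_window_or_spread δs U hU hne z hz hroot (fun φ hφ V hV hneV A B hw => ?_) (fun V hV hneV y hy hy0 ht hr => ?_)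
  · exact no_twenty_window_weylQuadruple (fun ν => δs (φ ν)) δ0 (fun l => (hδ l).comp hφ.tendsto_atTop) h32 h42 h52 hvg V hV hneV A B hw
  · exact hspread δs δ0 hδ h32 h42 h52 hvg V hV hneV y hy hy0 ht hr

/-- **THE CHAIN `h51` OF #91 FOLLOWS FROM ITS SPREAD CASE** (window case: #104 `no_twenty_window_weylQuintuple`). [this work] -/
theorem h51_of_spread
    (hspread : ∀ (δs : ℕ → Fin 6 → ℝ) (δ0 : Fin 6 → ℝ), (∀ l, Tendsto (fun ν => δs ν l) atTop (𝓝 (δ0 l))) →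
      δ0 2 = δ0 1 → δ0 3 = δ0 1 → δ0 4 = δ0 1 → δ0 5 = δ0 1 → δ0 0 ≠ δ0 1 →
      ∀ (U : ℕ → Fin 6 → Matrix (Fin 2) (Fin 2) ℝ), (∀ ν l, (U ν l).IsSymm) →
      (∀ ν, ∃ t, (∑ l, Real.exp (δs ν l * t) • U ν l).det ≠ 0) →
      ∀ (z : ℕ → Fin 20 → ℝ), (∀ ν, StrictMono (z ν)) → (∀ ν, z ν 0 = 0) → Tendsto (fun ν => z ν 19) atTop atTop →
      (∀ ν i, (∑ l, Real.exp (δs ν l * z ν i) • U ν l).det = 0) → False) :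
    ∀ (δs : ℕ → Fin 6 → ℝ) (δ0 : Fin 6 → ℝ), (∀ l, Tendsto (fun ν => δs ν l) atTop (𝓝 (δ0 l))) →
      δ0 2 = δ0 1 → δ0 3 = δ0 1 → δ0 4 = δ0 1 → δ0 5 = δ0 1 → δ0 0 ≠ δ0 1 →
      ∀ (U : ℕ → Fin 6 → Matrix (Fin 2) (Fin 2) ℝ), (∀ ν l, (U ν l).IsSymm) →
      (∀ ν, ∃ t, (∑ l, Real.exp (δs ν l * t) • U ν l).det ≠ 0) →
      ∀ (z : ℕ → Fin 20 → ℝ), (∀ ν, StrictMono (z ν)) → (∀ ν i, (∑ l, Real.exp (δs ν l * z ν i) • U ν l).det = 0) → False := by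
  intro δs δ0 hδ h21 h31 h41 h51 h01 U hU hne z hz hroot
  refine twenties_window_or_spread δs U hU hne z hz hroot (fun φ hφ V hV hneV A B hw => ?_) (fun V hV hneV y hy hy0 ht hr => ?_)
  · exact no_twenty_window_weylQuintuple (fun ν => δs (φ ν)) δ0 (fun l => (hδ l).comp hφ.tendsto_atTop) h21 h31 h41 h51 h01 V hV hneV A B hw
  · exact hspread δs δ0 hδ h21 h31 h41 h51 h01 V hV hneV y hy hy0 ht hr

/-- **`TripleStratum26` REDUCES TO FOUR SPREAD CHAINS AND THE TWO CHAINS [3,3], [4,2]** (predicates inlined verbatim as in #91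
`tripleStratum26_of_chains`). [this work] -/
theorem tripleStratum26_of_spreadChains
    (s3111 : ∀ (δs : ℕ → Fin 6 → ℝ) (δ0 : Fin 6 → ℝ), (∀ l, Tendsto (fun ν => δs ν l) atTop (𝓝 (δ0 l))) →
      δ0 4 = δ0 3 → δ0 5 = δ0 3 →
      (∀ a b c d : Fin 4, δ0 a.castSucc.castSucc + δ0 b.castSucc.castSucc = δ0 c.castSucc.castSucc + δ0 d.castSucc.castSucc →
        (a = c ∧ b = d) ∨ (a = d ∧ b = c)) →
      ∀ (U : ℕ → Fin 6 → Matrix (Fin 2) (Fin 2) ℝ), (∀ ν l, (U ν l).IsSymm) →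
      (∀ ν, ∃ t, (∑ l, Real.exp (δs ν l * t) • U ν l).det ≠ 0) →
      ∀ (z : ℕ → Fin 20 → ℝ), (∀ ν, StrictMono (z ν)) → (∀ ν, z ν 0 = 0) → Tendsto (fun ν => z ν 19) atTop atTop →
      (∀ ν i, (∑ l, Real.exp (δs ν l * z ν i) • U ν l).det = 0) → False)
    (s321 : ∀ (δs : ℕ → Fin 6 → ℝ) (δ0 : Fin 6 → ℝ), (∀ l, Tendsto (fun ν => δs ν l) atTop (𝓝 (δ0 l))) →
      δ0 1 = δ0 0 → δ0 4 = δ0 3 → δ0 5 = δ0 3 →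
      (∀ a b c d : Fin 3, δ0 ((![0, 2, 3] : Fin 3 → Fin 6) a) + δ0 ((![0, 2, 3] : Fin 3 → Fin 6) b)
          = δ0 ((![0, 2, 3] : Fin 3 → Fin 6) c) + δ0 ((![0, 2, 3] : Fin 3 → Fin 6) d) → (a = c ∧ b = d) ∨ (a = d ∧ b = c)) →
      ∀ (U : ℕ → Fin 6 → Matrix (Fin 2) (Fin 2) ℝ), (∀ ν l, (U ν l).IsSymm) →
      (∀ ν, ∃ t, (∑ l, Real.exp (δs ν l * t) • U ν l).det ≠ 0) →
      ∀ (z : ℕ → Fin 20 → ℝ), (∀ ν, StrictMono (z ν)) → (∀ ν, z ν 0 = 0) → Tendsto (fun ν => z ν 19) atTop atTop →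
      (∀ ν i, (∑ l, Real.exp (δs ν l * z ν i) • U ν l).det = 0) → False)
    (h33 : ∀ (δs : ℕ → Fin 6 → ℝ) (δ0 : Fin 6 → ℝ), (∀ l, Tendsto (fun ν => δs ν l) atTop (𝓝 (δ0 l))) →
      δ0 1 = δ0 0 → δ0 2 = δ0 0 → δ0 4 = δ0 3 → δ0 5 = δ0 3 → δ0 0 ≠ δ0 3 →
      ∀ (U : ℕ → Fin 6 → Matrix (Fin 2) (Fin 2) ℝ), (∀ ν l, (U ν l).IsSymm) →
      (∀ ν, ∃ t, (∑ l, Real.exp (δs ν l * t) • U ν l).det ≠ 0) →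
      ∀ (z : ℕ → Fin 20 → ℝ), (∀ ν, StrictMono (z ν)) → (∀ ν i, (∑ l, Real.exp (δs ν l * z ν i) • U ν l).det = 0) → False)
    (s411 : ∀ (δs : ℕ → Fin 6 → ℝ) (δ0 : Fin 6 → ℝ), (∀ l, Tendsto (fun ν => δs ν l) atTop (𝓝 (δ0 l))) →
      δ0 3 = δ0 2 → δ0 4 = δ0 2 → δ0 5 = δ0 2 →
      (∀ a b c d : Fin 3, δ0 a.castSucc.castSucc.castSucc + δ0 b.castSucc.castSucc.castSucc
          = δ0 c.castSucc.castSucc.castSucc + δ0 d.castSucc.castSucc.castSucc → (a = c ∧ b = d) ∨ (a = d ∧ b = c)) →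
      ∀ (U : ℕ → Fin 6 → Matrix (Fin 2) (Fin 2) ℝ), (∀ ν l, (U ν l).IsSymm) →
      (∀ ν, ∃ t, (∑ l, Real.exp (δs ν l * t) • U ν l).det ≠ 0) →
      ∀ (z : ℕ → Fin 20 → ℝ), (∀ ν, StrictMono (z ν)) → (∀ ν, z ν 0 = 0) → Tendsto (fun ν => z ν 19) atTop atTop →
      (∀ ν i, (∑ l, Real.exp (δs ν l * z ν i) • U ν l).det = 0) → False)
    (h42 : ∀ (δs : ℕ → Fin 6 → ℝ) (δ0 : Fin 6 → ℝ), (∀ l, Tendsto (fun ν => δs ν l) atTop (𝓝 (δ0 l))) →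
      δ0 1 = δ0 0 → δ0 3 = δ0 2 → δ0 4 = δ0 2 → δ0 5 = δ0 2 → δ0 0 ≠ δ0 2 →
      ∀ (U : ℕ → Fin 6 → Matrix (Fin 2) (Fin 2) ℝ), (∀ ν l, (U ν l).IsSymm) →
      (∀ ν, ∃ t, (∑ l, Real.exp (δs ν l * t) • U ν l).det ≠ 0) →
      ∀ (z : ℕ → Fin 20 → ℝ), (∀ ν, StrictMono (z ν)) → (∀ ν i, (∑ l, Real.exp (δs ν l * z ν i) • U ν l).det = 0) → False)
    (s51 : ∀ (δs : ℕ → Fin 6 → ℝ) (δ0 : Fin 6 → ℝ), (∀ l, Tendsto (fun ν => δs ν l) atTop (𝓝 (δ0 l))) →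
      δ0 2 = δ0 1 → δ0 3 = δ0 1 → δ0 4 = δ0 1 → δ0 5 = δ0 1 → δ0 0 ≠ δ0 1 →
      ∀ (U : ℕ → Fin 6 → Matrix (Fin 2) (Fin 2) ℝ), (∀ ν l, (U ν l).IsSymm) →
      (∀ ν, ∃ t, (∑ l, Real.exp (δs ν l * t) • U ν l).det ≠ 0) →
      ∀ (z : ℕ → Fin 20 → ℝ), (∀ ν, StrictMono (z ν)) → (∀ ν, z ν 0 = 0) → Tendsto (fun ν => z ν 19) atTop atTop →
      (∀ ν i, (∑ l, Real.exp (δs ν l * z ν i) • U ν l).det = 0) → False) :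
    ∀ δ ∈ SortedSimplex, (∃ i j k : Fin 6, i ≠ j ∧ i ≠ k ∧ j ≠ k ∧ δ i = δ j ∧ δ i = δ k) →
      (∀ a b c d : Fin 6, δ a + δ b = δ c + δ d → (δ a = δ c ∧ δ b = δ d) ∨ (δ a = δ d ∧ δ b = δ c)) →
      δ ∉ closure TwentyLocus :=
  tripleStratum26_of_chains (h3111_of_spread s3111) (h321_of_spread s321) h33 (h411_of_spread s411) h42 (h51_of_spread s51)

end Summit.ValiantsHypothesis.ValiantsHypothesis.Theorems.LacunarySymmetroidMatrixDescartes.WallBubbling
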